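import Literature.AlgebraicGeometry.Morphisms.FormalFunctionsGradedCechProofs
import Literature.AlgebraicGeometry.Morphisms.CechH1Pullback
import Literature.AlgebraicGeometry.Morphisms.CechH0Projective
import Literature.AlgebraicGeometry.Morphisms.SteinFactorizationLocalCriterion
import Literature.AlgebraicGeometry.Motives.ProjBaseChangeAny
import HarnessLib

/-!
# Zariski's connectedness theorem for projective schemes over a Noetherian local ring — auxiliaries

Auxiliary results for `Literature/AlgebraicGeometry/Morphisms/ZariskiConnectednessProjective.lean`, which
proves the local connectedness core of The Stacks Project, Tag 03H2 (1) (input `hConn` of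
`steinFactorization_geometricallyConnected_of_localConn`,
`Literature/AlgebraicGeometry/Morphisms/SteinFactorizationLocalCriterion.lean`) for PROJECTIVE schemes
over Noetherian local rings — Zariski's connectedness theorem, Hartshorne III Cor. 11.3 / Stacks
Tag 03H0, proof of Theorem 37.53.4 — by induction on the number of generators of an ideal of definition
of the base, cutting by one parameter `a` at a time and passing from `Y → Spec B` to
`Y_M → Spec Γ(Y_M, 𝒪)` for the infinitesimal neighbourhood `Y_M = Y ×_B B/(a^{M+1})`. This file
provides, for `g : Y → Spec B` and an ideal `I ⊆ B` (namespace `ZariskiProj`):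

* `range_ι`, `surjective_of_comp_ι` — all `Y_n → Y` have image `g⁻¹V(I)`; morphisms `Y_L → Y_M` over
  `Y` are onto;
* `toSpecΓ_SpecMap_algebraMapΓ`, `comap_algebraMapΓ_toSpecΓ`, `toSpecΓ_comp_apply`,
  `toSpecΓ_surjective` — the structure map through `Spec Γ(X, 𝒪_X)`, on points, and its surjectivity for
  `X → Spec A` universally closed (Mathlib: `X → Spec Γ(X, 𝒪_X)` is dominant);
* `finite_algebraMapΓ_level`, `isIntegral_algebraMapΓ_level` — `Γ(Y_n, 𝒪)` is finite over `B`
  Noetherian for `Y ↪ 𝐏^r_B` closed (the tree's `finite_algebraMapΓ_of_isClosedImmersion`, Hartshorne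
  III Thm. 5.2 (a)), and integral over `B` for `g` universally closed;
* `isLocalRing_Γ_of_ML` — **`Γ(Y_M, 𝒪)` is local** for `B` local, `I ⊆ 𝔪_B`, `g` universally closed
  with `B ≅ Γ(Y, 𝒪_Y)`, as soon as some `e : Y_L → Y_M` over `Y` has the Mittag-Leffler property
  "every function on `Y_M` restricts on `Y_L` to the restriction of a global function": every maximal
  ideal of `Γ(Y_M, 𝒪)` is `ψ⁻¹` (`ψ = e^*`) of the prime of a point of `Y_L` over `𝔪_B`, and all these
  coincide since `im ψ ⊆ im (B → Γ(Y_L, 𝒪))` (`comap_eq_comap_of_forall_exists`) — this is how the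
  printed proof of Tag 03H0 ("`(f_*𝒪_X)_s → H⁰(X_s, 𝒪)` … idempotents") is run here without the full
  theorem on formal functions; `isLocalHom_algebraMapΓ`;
* `maximalIdeal_le_radical_span` — the ideal of definition descends: `𝔪_B ⊆ √(a, s')`, `a ∈ I`, gives
  `𝔪_{Γ(Y_M,𝒪)} ⊆ √(s' Γ(Y_M, 𝒪))` (`a` is nilpotent on `Y_M`; the maximal ideal is the only prime over
  `𝔪_B`);
* `exists_isClosedImmersion_of_factor`, `exists_isClosedImmersion_pullback`,
  `exists_isClosedImmersion_level` — projectivity (a closed `B`-immersion into `𝐏^r_B`) passes to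
  factorisations `X → Spec B' → Spec B` of the structure map, to affine base changes, and in particular
  to `Y_M → Spec Γ(Y_M, 𝒪)` (`𝐏^r_{B'} = 𝐏^r_B ×_B Spec B'`, the tree's
  `ProjBaseChangeRing.isPullback_projMap'`; pasting of cartesian squares);
* `preconnectedSpace_closedFibre_of_level` — the closed fibre of `Y → Spec B` is a quotient of the
  closed fibre of `Y_M → Spec Γ(Y_M, 𝒪)`, hence preconnected if the latter is;
* `preconnectedSpace_closedFibre_of_le_nilradical` — the base case `𝔪_B` nilpotent: the closed fibre
  is all of `Y`, preconnected as `Γ(Y, 𝒪_Y) ≅ B` is local.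

Everything is proved; the file declares theorems only; no named facts are introduced.

## References

* The Stacks Project, Tag 03H0 (More on Morphisms, Theorem 37.53.4, proof), Tag 03H2 (Theorem 37.53.5),
  Tag 0G7X (Derived Categories of Schemes, Lemma 36.32.7).
* R. Hartshorne, *Algebraic Geometry*, GTM 52 (1977), III Cor. 11.3, III Thm. 5.2 (a).
* U. Görtz, T. Wedhorn, *Algebraic Geometry I*, 2nd ed. (2020), (13.9).
-/

noncomputable section

open CategoryTheory AlgebraicGeometry Limits TopologicalSpace Opposite

universe u

namespace Literature.AlgebraicGeometry.Morphisms

namespace ZariskiProj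

open infinitesimalNeighbourhood IsLocalRing

variable {B : Type u} [CommRing B] {Y : Scheme.{u}} (g : Y ⟶ Spec (.of B)) (I : Ideal B)

/-! ### Infinitesimal neighbourhoods: underlying sets -/

/-- The closed immersions `ι_n : Y_n → Y` of the infinitesimal neighbourhoods
`Y_n = Y ×_B B/I^{n+1}` all have the same image `g⁻¹ V(I)`. [folklore] -/
theorem range_ι (n : ℕ) :
    Set.range (ι I g n) = g ⁻¹' PrimeSpectrum.zeroLocus (I : Set B) := by
  rw [Scheme.Pullback.range_fst]
  congr 1
  change Set.range (Spec.map (CommRingCat.ofHom (Ideal.Quotient.mk (I ^ (n + 1))))) = _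
  have : Set.range (Spec.map (CommRingCat.ofHom (Ideal.Quotient.mk (I ^ (n + 1))))) =
      Set.range (PrimeSpectrum.comap (Ideal.Quotient.mk (I ^ (n + 1)))) := rfl
  rw [this, range_comap_of_surjective _ _ Ideal.Quotient.mk_surjective, Ideal.mk_ker,
    PrimeSpectrum.zeroLocus_pow _ (Nat.succ_ne_zero n)]

/-- A morphism `e : Y_L → Y_M` of infinitesimal neighbourhoods over `Y` is onto (both have
underlying set `g⁻¹ V(I)` and `ι_M` is injective). [folklore] -/
theorem surjective_of_comp_ι {L M : ℕ} (e : infinitesimalNeighbourhood I g L ⟶ infinitesimalNeighbourhood I g M)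
    (he : e ≫ ι I g M = ι I g L) : Function.Surjective e := by
  intro y
  have hy : (ι I g M) y ∈ Set.range (ι I g L) := by
    rw [range_ι g I L, ← range_ι g I M]; exact ⟨y, rfl⟩
  obtain ⟨x, hx⟩ := hy
  refine ⟨x, (ι I g M).isClosedEmbedding.injective ?_⟩
  rw [← Scheme.Hom.comp_apply, he, hx]

section Local

variable [IsLocalRing B] (hI : I ≤ maximalIdeal B)
include hI

/-- For `I ⊆ 𝔪_B` the closed fibre `Y ×_B κ_B` maps to every infinitesimal neighbourhood `Y_n`
(over `Y`). [folklore] -/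
theorem exists_closedFibre_to (n : ℕ) :
    ∃ c : pullback g (Spec.map (CommRingCat.ofHom (residue B))) ⟶ infinitesimalNeighbourhood I g n,
      c ≫ ι I g n = pullback.fst g (Spec.map (CommRingCat.ofHom (residue B))) := by
  have hle : I ^ (n + 1) ≤ maximalIdeal B := (Ideal.pow_le_self (Nat.succ_ne_zero n)).trans hI
  refine ⟨pullback.map g (Spec.map (CommRingCat.ofHom (residue B))) g (base I n) (𝟙 Y)
    (Spec.map (CommRingCat.ofHom (Ideal.Quotient.factor hle))) (𝟙 _)
    (by rw [Category.comp_id, Category.id_comp]) ?_, ?_⟩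
  · rw [Category.comp_id]
    change Spec.map _ = Spec.map _ ≫ Spec.map _
    rw [← Spec.map_comp, ← CommRingCat.ofHom_comp]
    rfl
  · exact (pullback.lift_fst _ _ _).trans (Category.comp_id _)

/-- Hence `Y_n` is non-empty as soon as the closed fibre is. [folklore] -/
theorem nonempty_infinitesimalNeighbourhood (n : ℕ)
    [Nonempty ↥(pullback g (Spec.map (CommRingCat.ofHom (residue B))))] :
    Nonempty ↥(infinitesimalNeighbourhood I g n) := by
  obtain ⟨c, -⟩ := exists_closedFibre_to g I hI n
  exact ⟨c (Classical.arbitrary _)⟩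

end Local

/-! ### The ring of functions of `Y_n` for `Y` projective over `B` -/

section Projective

variable {r : ℕ} (j : Y ⟶ ProjCech.PP B r) [IsClosedImmersion j] (hj : j ≫ ProjCech.toSpec B r = g)
include hj

/-- For `Y` closed in `𝐏^r_B` and `B` Noetherian, `Γ(Y_n, 𝒪)` is a finite `B`-module (the tree's
finiteness of `H⁰` for closed subschemes of `𝐏^r_B`, `finite_algebraMapΓ_of_isClosedImmersion`,
applied to `Y_n ↪ Y ↪ 𝐏^r_B`). [cite: Hartshorne1977, III Thm. 5.2 (a) p. 228 (PDF p. 284)] -/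
theorem finite_algebraMapΓ_level [IsNoetherianRing B] (n : ℕ) :
    (algebraMapΓ (ι I g n ≫ g)).Finite :=
  finite_algebraMapΓ_of_isClosedImmersion (ι I g n ≫ g) (ι I g n ≫ j)
    (by rw [Category.assoc, hj])

omit [IsClosedImmersion j] hj in
/-- `Γ(Y_n, 𝒪)` is integral over `B` for `g` universally closed. [folklore] -/
theorem isIntegral_algebraMapΓ_level [UniversallyClosed g] (n : ℕ) :
    (algebraMapΓ (ι I g n ≫ g)).IsIntegral := by
  unfold algebraMapΓ
  exact RingHom.IsIntegral.trans _ _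
    (RingHom.isIntegral_of_surjective _ (Scheme.ΓSpecIso (.of B)).commRingCatIsoToRingEquiv.symm.surjective)
    (isIntegral_appTop_of_universallyClosed (ι I g n ≫ g))

end Projective

/-! ### Points of `Spec Γ(X, 𝒪_X)` and the structure map -/

section ToSpecΓ

variable {A : Type u} [CommRing A] {X : Scheme.{u}} (f : X ⟶ Spec (.of A))

omit g I in
/-- `X → Spec Γ(X, 𝒪_X) → Spec A` is the structure morphism. [folklore] -/
theorem toSpecΓ_SpecMap_algebraMapΓ :
    X.toSpecΓ ≫ Spec.map (CommRingCat.ofHom (algebraMapΓ f)) = f := by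
  have e : CommRingCat.ofHom (algebraMapΓ f) = (Scheme.ΓSpecIso (.of A)).inv ≫ f.appTop := by
    rw [algebraMapΓ, CommRingCat.ofHom_comp, CommRingCat.ofHom_hom, CommRingCat.ofHom_hom]
  rw [e, Spec.map_comp, ← Scheme.toSpecΓ_naturality_assoc, toSpecΓ_SpecMap_ΓSpecIso_inv,
    Category.comp_id]

omit g I in
/-- On points: the prime of `Γ(X, 𝒪_X)` at `x` contracts to the image of `x` in `Spec A`.
[folklore] -/
theorem comap_algebraMapΓ_toSpecΓ (x : X) :
    (X.toSpecΓ x).asIdeal.comap (algebraMapΓ f) = (f x).asIdeal := by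
  conv_rhs => rw [← toSpecΓ_SpecMap_algebraMapΓ f]
  rfl

omit g I in
/-- On points, for a morphism `e : X → X'` of `A`-schemes: the prime of `Γ(X', 𝒪)` at `e x` is the
contraction of the prime of `Γ(X, 𝒪)` at `x`. [folklore] -/
theorem toSpecΓ_comp_apply {X' : Scheme.{u}} (e : X ⟶ X') (x : X) :
    (X'.toSpecΓ (e x)).asIdeal = (X.toSpecΓ x).asIdeal.comap e.appTop.hom := by
  have h := congrArg (fun φ ↦ (φ x).asIdeal) (Scheme.toSpecΓ_naturality e)
  exact h

omit g I in
/-- `X → Spec Γ(X, 𝒪_X)` is surjective for `X → Spec A` universally closed (it is dominant, Mathlib,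
and universally closed by cancellation). [folklore] -/
theorem toSpecΓ_surjective [UniversallyClosed f] : Function.Surjective X.toSpecΓ := by
  haveI : CompactSpace X := QuasiCompact.compactSpace_of_compactSpace f
  have : UniversallyClosed (X.toSpecΓ ≫ Spec.map (CommRingCat.ofHom (algebraMapΓ f))) := by
    rw [toSpecΓ_SpecMap_algebraMapΓ]; infer_instance
  haveI : UniversallyClosed X.toSpecΓ :=
    .of_comp_of_isSeparated _ (Spec.map (CommRingCat.ofHom (algebraMapΓ f)))
  exact (surjective_of_isDominant_of_isClosed_range _ X.toSpecΓ.isClosedMap.isClosed_range).surj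

end ToSpecΓ

/-! ### `Γ(Y_M, 𝒪)` is local when the image of `Γ(Y_M, 𝒪) → Γ(Y_L, 𝒪)` is that of `Γ(Y, 𝒪) = B` -/

section IsLocal

omit g I in
/-- Contractions along `ψ : B_M → B_L` of two primes of `B_L` with the same contraction to `B`
agree, provided the image of `ψ` is contained in that of `B → B_L`. [folklore] -/
theorem comap_eq_comap_of_forall_exists {BL BM : Type*} [CommRing BL] [CommRing BM]
    (φL : B →+* BL) (ψ : BM →+* BL) (hψ : ∀ t, ∃ b, ψ t = φL b) {Q Q' : Ideal BL}
    (h : Q.comap φL = Q'.comap φL) : Q.comap ψ = Q'.comap ψ := by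
  ext t
  obtain ⟨b, hb⟩ := hψ t
  rw [Ideal.mem_comap, Ideal.mem_comap, hb, ← Ideal.mem_comap, h, Ideal.mem_comap]

variable [IsLocalRing B] (hI : I ≤ maximalIdeal B) [UniversallyClosed g] [IsIso g.appTop]

include hI in
/-- **`Γ(Y_M, 𝒪)` is a local ring** when `B` is local, `g : Y → Spec B` is universally closed with
`B ≅ Γ(Y, 𝒪_Y)`, `I ⊆ 𝔪_B`, and for some morphism `e : Y_L → Y_M` over `Y` every function on `Y_M`
restricts on `Y_L` to the restriction of a global function on `Y` (the Mittag-Leffler condition).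
Proof: every maximal ideal `P` of `B_M = Γ(Y_M, 𝒪)` lies over `𝔪_B` (`B_M` is integral over `B`) and
is the prime of a point `y = e x` of `Y_M` (`Y_M → Spec B_M` is onto, `e` is onto), hence
`P = ψ⁻¹(Q)` for `ψ = e^* : B_M → B_L` and the prime `Q` of `B_L` at `x`, which lies over `𝔪_B`; by
the Mittag-Leffler condition `im ψ ⊆ im (B → B_L)`, so all such `ψ⁻¹(Q)` coincide
(`comap_eq_comap_of_forall_exists`). [cite: StacksProject, Tag 03H0 (More on Morphisms, Theorem 37.53.4, proof)] -/
theorem isLocalRing_Γ_of_ML {L M : ℕ}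
    (e : infinitesimalNeighbourhood I g L ⟶ infinitesimalNeighbourhood I g M) (he : e ≫ ι I g M = ι I g L)
    (hML : ∀ t : Γ(infinitesimalNeighbourhood I g M, ⊤), ∃ m : Γ(Y, ⊤),
      restrict I g L m = e.appTop.hom t) :
    IsLocalRing Γ(infinitesimalNeighbourhood I g M, ⊤) := by
  -- notation and basic facts
  haveI : Nonempty ↥(pullback g (Spec.map (CommRingCat.ofHom (residue B)))) :=
    SteinFibre.nonempty_closedFibre g
  haveI : Nonempty ↥(infinitesimalNeighbourhood I g M) := nonempty_infinitesimalNeighbourhood g I hI M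
  haveI : Nontrivial Γ(infinitesimalNeighbourhood I g M, ⊤) :=
    ((infinitesimalNeighbourhood I g M).presheaf.germ ⊤ (Classical.arbitrary _) trivial).hom.domain_nontrivial
  have hint : (algebraMapΓ (ι I g M ≫ g)).IsIntegral := isIntegral_algebraMapΓ_level g I M
  have hψφ : e.appTop.hom.comp (algebraMapΓ (ι I g M ≫ g)) = algebraMapΓ (ι I g L ≫ g) := by
    ext b
    exact Sections.appTop_algebraMapΓ (ι I g M ≫ g) (ι I g L ≫ g) e (by rw [← Category.assoc, he]) b
  -- the Mittag-Leffler condition: `im ψ ⊆ im φ_L`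
  have hrange : ∀ t, ∃ b, e.appTop.hom t = algebraMapΓ (ι I g L ≫ g) b := by
    intro t
    obtain ⟨m, hm⟩ := hML t
    obtain ⟨b, rfl⟩ : ∃ b, algebraMapΓ g b = m := by
      refine ⟨(Scheme.ΓSpecIso (.of B)).hom (inv g.appTop m), ?_⟩
      change g.appTop.hom ((Scheme.ΓSpecIso (.of B)).inv ((Scheme.ΓSpecIso (.of B)).hom _)) = m
      rw [Iso.hom_inv_id_apply, ← CommRingCat.comp_apply, IsIso.inv_hom_id]
      rfl
    exact ⟨b, by rw [← hm]; exact (Sections.appTop_algebraMapΓ g (ι I g L ≫ g) (ι I g L) rfl b).symm⟩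
  -- every maximal ideal is `ψ⁻¹` of a prime of `B_L` over `𝔪_B`
  have hform : ∀ P : Ideal Γ(infinitesimalNeighbourhood I g M, ⊤), P.IsMaximal →
      ∃ Q : Ideal Γ(infinitesimalNeighbourhood I g L, ⊤),
        Q.comap (algebraMapΓ (ι I g L ≫ g)) = maximalIdeal B ∧ P = Q.comap e.appTop.hom := by
    intro P hP
    obtain ⟨y, hy⟩ := toSpecΓ_surjective (ι I g M ≫ g) ⟨P, hP.isPrime⟩
    obtain ⟨x, rfl⟩ := surjective_of_comp_ι g I e he y
    refine ⟨((infinitesimalNeighbourhood I g L).toSpecΓ x).asIdeal, ?_, ?_⟩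
    · rw [← hψφ, ← Ideal.comap_comap, ← toSpecΓ_comp_apply, hy]
      have hmax : (P.comap (algebraMapΓ (ι I g M ≫ g))).IsMaximal :=
        Ideal.isMaximal_comap_of_isIntegral_of_isMaximal' _ hint P
      exact IsLocalRing.eq_maximalIdeal hmax
    · rw [← toSpecΓ_comp_apply, hy]
  -- hence all maximal ideals coincide
  obtain ⟨P₀, hP₀⟩ := Ideal.exists_maximal Γ(infinitesimalNeighbourhood I g M, ⊤)
  refine IsLocalRing.of_unique_max_ideal ⟨P₀, hP₀, fun P hP ↦ ?_⟩
  obtain ⟨Q, hQ, rfl⟩ := hform P hP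
  obtain ⟨Q₀, hQ₀, rfl⟩ := hform P₀ hP₀
  exact comap_eq_comap_of_forall_exists (algebraMapΓ (ι I g L ≫ g)) e.appTop.hom hrange
    (hQ.trans hQ₀.symm)

omit [IsIso g.appTop] in
/-- The structure map `B → Γ(Y_M, 𝒪)` is a local homomorphism (its target being local as above):
the maximal ideal of `Γ(Y_M, 𝒪)` lies over `𝔪_B` by integrality. [folklore] -/
theorem isLocalHom_algebraMapΓ (M : ℕ) [IsLocalRing Γ(infinitesimalNeighbourhood I g M, ⊤)] :
    IsLocalHom (algebraMapΓ (ι I g M ≫ g)) := by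
  have hint : (algebraMapΓ (ι I g M ≫ g)).IsIntegral := isIntegral_algebraMapΓ_level g I M
  have hmax := Ideal.isMaximal_comap_of_isIntegral_of_isMaximal' _ hint
    (maximalIdeal Γ(infinitesimalNeighbourhood I g M, ⊤))
  refine ((IsLocalRing.local_hom_TFAE (algebraMapΓ (ι I g M ≫ g))).out 4 0).mp ?_
  exact IsLocalRing.eq_maximalIdeal hmax

omit [IsIso g.appTop] in
/-- **The radical condition descends**: if `𝔪_B ⊆ √(a, s'_1, …, s'_t)` with `a ∈ I`, then in the local
ring `Γ(Y_M, 𝒪)` (integral over `B`, where `a` is nilpotent as `a^{M+1} ∈ I^{M+1}` vanishes on `Y_M`)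
the maximal ideal is contained in `√(s'_1, …, s'_t)`: it equals `√(𝔪_B Γ(Y_M, 𝒪))` (the only prime
over `𝔪_B`). [folklore] -/
theorem maximalIdeal_le_radical_span (M : ℕ) [IsLocalRing Γ(infinitesimalNeighbourhood I g M, ⊤)]
    {a : B} (ha : a ∈ I) {t : ℕ} (s' : Fin t → B)
    (hrad : maximalIdeal B ≤ (Ideal.span (insert a (Set.range s'))).radical) :
    maximalIdeal Γ(infinitesimalNeighbourhood I g M, ⊤) ≤
      (Ideal.span (Set.range (algebraMapΓ (ι I g M ≫ g) ∘ s'))).radical := by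
  set φ := algebraMapΓ (ι I g M ≫ g) with hφ
  have hint : φ.IsIntegral := isIntegral_algebraMapΓ_level g I M
  -- (1) `𝔪_{B_M} ≤ √(𝔪_B B_M)`
  have h1 : maximalIdeal Γ(infinitesimalNeighbourhood I g M, ⊤) ≤ ((maximalIdeal B).map φ).radical := by
    rw [Ideal.radical_eq_sInf]
    refine le_sInf fun p ⟨hp, hprime⟩ ↦ ?_
    haveI := hprime
    have hc : (p.comap φ) = maximalIdeal B := by
      refine (IsLocalRing.maximalIdeal.isMaximal B).eq_of_le (Ideal.IsPrime.ne_top inferInstance)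
        (Ideal.map_le_iff_le_comap.mp hp) |>.symm
    have hpmax : p.IsMaximal :=
      Ideal.isMaximal_of_isIntegral_of_isMaximal_comap' φ hint p (hc ▸ IsLocalRing.maximalIdeal.isMaximal B)
    exact (IsLocalRing.eq_maximalIdeal hpmax).ge
  -- (2) `𝔪_B B_M ≤ √((a, s') B_M)` and `(a, s') B_M = (φ a) + (φ ∘ s')`
  have h2 : (maximalIdeal B).map φ ≤ (Ideal.span (insert (φ a) (Set.range (φ ∘ s')))).radical := by
    refine (Ideal.map_mono hrad).trans ((Ideal.map_radical_le φ).trans (le_of_eq ?_))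
    rw [Ideal.map_span, Set.image_insert_eq, ← Set.range_comp]
  -- (3) `φ a` is nilpotent
  have h3 : IsNilpotent (φ a) := by
    refine ⟨M + 1, ?_⟩
    rw [← map_pow, hφ, ← Sections.appTop_algebraMapΓ g (ι I g M ≫ g) (ι I g M) rfl]
    exact restrict_map_mem_pow I g M (Ideal.pow_mem_pow ha _)
  have h4 : (Ideal.span (insert (φ a) (Set.range (φ ∘ s')))).radical ≤
      (Ideal.span (Set.range (φ ∘ s'))).radical := by
    rw [Ideal.span_insert, Ideal.radical_sup]
    refine Ideal.radical_le_radical_iff.mpr (sup_le ?_ le_rfl)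
    rw [Ideal.radical_le_radical_iff, Ideal.span_singleton_le_iff_mem]
    exact Ideal.radical_mono bot_le (mem_nilradical.mpr h3)
  calc maximalIdeal Γ(infinitesimalNeighbourhood I g M, ⊤)
      ≤ ((maximalIdeal B).map φ).radical := h1
    _ ≤ (Ideal.span (insert (φ a) (Set.range (φ ∘ s')))).radical :=
        (Ideal.radical_mono h2).trans (le_of_eq (Ideal.radical_idem _))
    _ ≤ _ := h4

end IsLocal

/-! ### Projectivity is preserved: factorisations and base change -/

section ProjFactor

omit g I in
/-- **Projectivity along a factorisation of the structure map.** If `j : X ↪ 𝐏^r_B` is a closed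
`B`-immersion and the structure map factors as `X → Spec B' → Spec B` (`g'` and `φ : B → B'`), then
`(j, g') : X → 𝐏^r_B ×_B Spec B' ≅ 𝐏^r_{B'}` (base change of projective space, the tree's
`ProjBaseChangeRing.isPullback_projMap'`) is a closed `B'`-immersion, its composite with the separated
projection to `𝐏^r_B` being one. [cite: GortzWedhorn2020, (13.9) p. 395] -/
theorem exists_isClosedImmersion_of_factor {B' : Type u} [CommRing B'] {X : Scheme.{u}} {r : ℕ}
    (j : X ⟶ ProjCech.PP B r) [IsClosedImmersion j] (g' : X ⟶ Spec (.of B')) (φ : B →+* B')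
    (w : j ≫ ProjCech.toSpec B r = g' ≫ Spec.map (CommRingCat.ofHom φ)) :
    ∃ j' : X ⟶ ProjCech.PP B' r, IsClosedImmersion j' ∧ j' ≫ ProjCech.toSpec B' r = g' := by
  letI : Algebra B B' := φ.toAlgebra
  -- `𝐏^r_{B'} = 𝐏^r_B ×_B Spec B'`
  obtain ⟨fst', H⟩ : ∃ fst' : ProjCech.PP B' r ⟶ ProjCech.PP B r,
      IsPullback fst' (ProjCech.toSpec B' r) (ProjCech.toSpec B r) (Spec.map (CommRingCat.ofHom φ)) :=
    ⟨_, Motives.ProjBaseChangeRing.isPullback_projMap' B B' (n := r)⟩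
  refine ⟨H.lift j g' w, ?_, H.lift_snd _ _ w⟩
  haveI : IsSeparated fst' := MorphismProperty.of_isPullback H.flip inferInstance
  haveI : IsClosedImmersion (H.lift j g' w ≫ fst') := by rw [H.lift_fst]; infer_instance
  exact IsClosedImmersion.of_comp (H.lift j g' w) fst'

omit I in
/-- **Projectivity is stable under affine base change.** If `g : Y → Spec B` admits a closed
`B`-immersion `Y ↪ 𝐏^r_B`, then `Y ×_B Spec B' → Spec B'` admits a closed `B'`-immersion into
`𝐏^r_{B'} = 𝐏^r_B ×_B Spec B'` (the base change of the given one; pasting of cartesian squares).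
[cite: GortzWedhorn2020, (13.9) p. 395] -/
theorem exists_isClosedImmersion_pullback {B' : Type u} [CommRing B'] (φ : B →+* B') {r : ℕ}
    (j : Y ⟶ ProjCech.PP B r) [IsClosedImmersion j] (hj : j ≫ ProjCech.toSpec B r = g) :
    ∃ j' : pullback g (Spec.map (CommRingCat.ofHom φ)) ⟶ ProjCech.PP B' r, IsClosedImmersion j' ∧
      j' ≫ ProjCech.toSpec B' r = pullback.snd g (Spec.map (CommRingCat.ofHom φ)) := by
  letI : Algebra B B' := φ.toAlgebra
  obtain ⟨fst', H⟩ : ∃ fst' : ProjCech.PP B' r ⟶ ProjCech.PP B r,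
      IsPullback fst' (ProjCech.toSpec B' r) (ProjCech.toSpec B r) (Spec.map (CommRingCat.ofHom φ)) :=
    ⟨_, Motives.ProjBaseChangeRing.isPullback_projMap' B B' (n := r)⟩
  have s : IsPullback (pullback.fst g (Spec.map (CommRingCat.ofHom φ)))
      (pullback.snd g (Spec.map (CommRingCat.ofHom φ))) (j ≫ ProjCech.toSpec B r)
      (Spec.map (CommRingCat.ofHom φ)) := by
    rw [hj]; exact IsPullback.of_hasPullback _ _
  have top := IsPullback.of_bot' s H
  refine ⟨H.lift (pullback.fst g (Spec.map (CommRingCat.ofHom φ)) ≫ j)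
    (pullback.snd g (Spec.map (CommRingCat.ofHom φ))) (by rw [Category.assoc, s.w]), ?_, H.lift_snd _ _ _⟩
  exact MorphismProperty.of_isPullback top inferInstance

end ProjFactor

/-! ### `Y_M → Spec Γ(Y_M, 𝒪)` is projective -/

section ProjLevel

variable {r : ℕ} (j : Y ⟶ ProjCech.PP B r) [IsClosedImmersion j] (hj : j ≫ ProjCech.toSpec B r = g)
include hj

/-- **`Y_M` is projective over `Γ(Y_M, 𝒪)`**: the structure map of `Y_M ↪ Y ↪ 𝐏^r_B` factors through
`Y_M → Spec Γ(Y_M, 𝒪)`, so `exists_isClosedImmersion_of_factor` applies. [cite: GortzWedhorn2020, (13.9) p. 395] -/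
theorem exists_isClosedImmersion_level (M : ℕ) :
    ∃ j' : infinitesimalNeighbourhood I g M ⟶ ProjCech.PP Γ(infinitesimalNeighbourhood I g M, ⊤) r,
      IsClosedImmersion j' ∧
        j' ≫ ProjCech.toSpec Γ(infinitesimalNeighbourhood I g M, ⊤) r =
          (infinitesimalNeighbourhood I g M).toSpecΓ :=
  exists_isClosedImmersion_of_factor (ι I g M ≫ j) (infinitesimalNeighbourhood I g M).toSpecΓ
    (algebraMapΓ (ι I g M ≫ g)) (by rw [Category.assoc, hj, toSpecΓ_SpecMap_algebraMapΓ])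

end ProjLevel

/-! ### From the closed fibre of `Y_M → Spec Γ(Y_M, 𝒪)` to the closed fibre of `Y → Spec B` -/

omit g I in
/-- The target of a surjective morphism of schemes with preconnected source is preconnected.
[folklore] -/
theorem preconnectedSpace_of_surjective {X X' : Scheme.{u}} (p : X ⟶ X') (hp : Function.Surjective p)
    [PreconnectedSpace X] : PreconnectedSpace X' := by
  have h : _root_.IsPreconnected (Set.range p) := by
    rw [← Set.image_univ]; exact isPreconnected_univ.image _ p.continuous.continuousOn
  rw [hp.range_eq] at h
  exact ⟨h⟩

section Transfer

variable [IsLocalRing B] (hI : I ≤ maximalIdeal B) [UniversallyClosed g] (M : ℕ)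
  [IsLocalRing Γ(infinitesimalNeighbourhood I g M, ⊤)]
include hI

/-- **The closed fibre of `Y → Spec B` is a quotient of the closed fibre of `Y_M → Spec Γ(Y_M, 𝒪)`**
(`B` local, `I ⊆ 𝔪_B`, `Γ(Y_M, 𝒪)` local): there is a surjective morphism from the latter to the
former — a point `y` of `Y` over `𝔪_B` lies in `Y_M = g⁻¹V(I)` and its prime in `Γ(Y_M, 𝒪)` lies
over `𝔪_B`, hence is the maximal ideal — so the closed fibre of `Y` is preconnected as soon as that of
`Y_M` is. [folklore] -/
theorem preconnectedSpace_closedFibre_of_level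
    [PreconnectedSpace ↥(pullback (infinitesimalNeighbourhood I g M).toSpecΓ
      (Spec.map (CommRingCat.ofHom (residue Γ(infinitesimalNeighbourhood I g M, ⊤)))))] :
    PreconnectedSpace ↥(pullback g (Spec.map (CommRingCat.ofHom (residue B)))) := by
  haveI hloc : IsLocalHom (algebraMapΓ (ι I g M ≫ g)) := isLocalHom_algebraMapΓ g I M
  haveI : IsClosedImmersion (Spec.map (CommRingCat.ofHom (residue B))) :=
    IsClosedImmersion.spec_of_surjective _ Ideal.Quotient.mk_surjective
  haveI : IsClosedImmersion (pullback.fst g (Spec.map (CommRingCat.ofHom (residue B)))) :=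
    MorphismProperty.pullback_fst _ _ inferInstance
  set BM := Γ(infinitesimalNeighbourhood I g M, ⊤) with hBM
  set φ : B →+* BM := algebraMapΓ (ι I g M ≫ g) with hφ
  set hM := (infinitesimalNeighbourhood I g M).toSpecΓ with hhM
  have hfac : hM ≫ Spec.map (CommRingCat.ofHom φ) = ι I g M ≫ g := toSpecΓ_SpecMap_algebraMapΓ _
  -- the comparison morphism
  have hcomp : (pullback.fst hM (Spec.map (CommRingCat.ofHom (residue BM))) ≫ ι I g M) ≫ g =
      (pullback.snd hM (Spec.map (CommRingCat.ofHom (residue BM))) ≫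
        Spec.map (CommRingCat.ofHom (ResidueField.map φ))) ≫ Spec.map (CommRingCat.ofHom (residue B)) := by
    rw [Category.assoc, ← hfac, ← Category.assoc, pullback.condition, Category.assoc, Category.assoc,
      ← Spec.map_comp, ← Spec.map_comp, ← CommRingCat.ofHom_comp, ← CommRingCat.ofHom_comp,
      ResidueField.map_comp_residue]
  set π := pullback.lift _ _ hcomp with hπ
  refine preconnectedSpace_of_surjective π fun z ↦ ?_
  -- `y = fst z ∈ Y` lies over `𝔪_B`, hence in the image of `ι_M`
  have hz : g (pullback.fst g _ z) = closedPoint B := by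
    rw [← Scheme.Hom.comp_apply, pullback.condition, Scheme.Hom.comp_apply, Spec.map_apply,
      CommRingCat.hom_ofHom]
    exact IsLocalRing.PrimeSpectrum.comap_residue B _
  have hy : pullback.fst g _ z ∈ Set.range (ι I g M) := by
    rw [range_ι, Set.mem_preimage, hz]
    exact fun b hb ↦ hI hb
  obtain ⟨y', hy'⟩ := hy
  -- `y'` lies over the closed point of `Spec B_M`
  have hy'cl : hM y' = closedPoint BM := by
    apply PrimeSpectrum.ext
    have h1 : (hM y').asIdeal.comap φ = maximalIdeal B := by
      rw [hhM, hφ, comap_algebraMapΓ_toSpecΓ, Scheme.Hom.comp_apply, hy', hz]; rfl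
    have hint : φ.IsIntegral := isIntegral_algebraMapΓ_level g I M
    have hmax : (hM y').asIdeal.IsMaximal :=
      Ideal.isMaximal_of_isIntegral_of_isMaximal_comap' φ hint _ (h1 ▸ IsLocalRing.maximalIdeal.isMaximal B)
    exact IsLocalRing.eq_maximalIdeal hmax
  have hpt : (Spec.map (CommRingCat.ofHom (residue BM))) (closedPoint (ResidueField BM)) = closedPoint BM := by
    rw [Spec.map_apply, CommRingCat.hom_ofHom]
    exact IsLocalRing.PrimeSpectrum.comap_residue BM _
  obtain ⟨z', hz'1, -⟩ := Scheme.Pullback.exists_preimage_pullback (f := hM)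
    (g := Spec.map (CommRingCat.ofHom (residue BM))) y' (closedPoint (ResidueField BM))
    (hy'cl.trans hpt.symm)
  refine ⟨z', (pullback.fst g (Spec.map (CommRingCat.ofHom (residue B)))).isClosedEmbedding.injective ?_⟩
  rw [← Scheme.Hom.comp_apply, hπ, pullback.lift_fst, Scheme.Hom.comp_apply, hz'1, hy']

end Transfer

/-! ### The base case: `𝔪_B` nilpotent -/

section Base

variable [IsLocalRing B] [IsIso g.appTop]

omit I in
/-- If every element of `𝔪_B` is nilpotent then `Spec B` is a point and the closed fibre of
`g : Y → Spec B` is all of `Y` (topologically), which is preconnected because its ring of functions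
`B` is local (no non-trivial idempotents). [folklore] -/
theorem preconnectedSpace_closedFibre_of_le_nilradical (h : maximalIdeal B ≤ nilradical B) :
    PreconnectedSpace ↥(pullback g (Spec.map (CommRingCat.ofHom (residue B)))) := by
  -- `Y` is preconnected
  have eB : B ≃+* Γ(Y, ⊤) :=
    (Scheme.ΓSpecIso (.of B)).symm.commRingCatIsoToRingEquiv.trans (asIso g.appTop).commRingCatIsoToRingEquiv
  haveI : PreconnectedSpace Y := by
    refine Motives.preconnectedSpace_of_isIdempotentElem Y fun e he ↦ ?_
    obtain ⟨b, rfl⟩ := eB.surjective e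
    have hb : IsIdempotentElem b := by
      apply eB.injective; rw [map_mul]; exact he
    rcases IsLocalRing.isUnit_or_isUnit_one_sub_self b with hu | hu
    · right
      have h1 : b = 1 := hu.mul_left_cancel (hb.eq.trans (mul_one b).symm)
      rw [h1, map_one]
    · left
      have h1 : 1 - b = 1 := hu.mul_left_cancel (hb.one_sub.eq.trans (mul_one _).symm)
      rw [sub_eq_self.mp h1, map_zero]
  -- `F → Y` is a surjective closed immersion
  haveI : IsClosedImmersion (Spec.map (CommRingCat.ofHom (residue B))) :=
    IsClosedImmersion.spec_of_surjective _ Ideal.Quotient.mk_surjective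
  haveI : IsClosedImmersion (pullback.fst g (Spec.map (CommRingCat.ofHom (residue B)))) :=
    MorphismProperty.pullback_fst _ _ inferInstance
  have hsurj : Function.Surjective (pullback.fst g (Spec.map (CommRingCat.ofHom (residue B)))) := by
    intro y
    have hy : g y = closedPoint B := by
      apply PrimeSpectrum.ext
      exact ((IsLocalRing.maximalIdeal.isMaximal B).eq_of_le (g y).isPrime.ne_top
        (h.trans (nilradical_le_prime (g y).asIdeal))).symm
    have hpt : (Spec.map (CommRingCat.ofHom (residue B))) (closedPoint (ResidueField B)) = closedPoint B := by
      rw [Spec.map_apply, CommRingCat.hom_ofHom]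
      exact IsLocalRing.PrimeSpectrum.comap_residue B _
    obtain ⟨z, hz, -⟩ := Scheme.Pullback.exists_preimage_pullback (f := g)
      (g := Spec.map (CommRingCat.ofHom (residue B))) y (closedPoint (ResidueField B)) (hy.trans hpt.symm)
    exact ⟨z, hz⟩
  constructor
  rw [← (pullback.fst g (Spec.map (CommRingCat.ofHom (residue B)))).isClosedEmbedding.isInducing.isPreconnected_image,
    Set.image_univ, hsurj.range_eq]
  exact isPreconnected_univ

end Base

end ZariskiProj

end Literature.AlgebraicGeometry.Morphisms

end
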